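/-
Origin: expansion seat `planner-pub-hodgecm-pv06-g4-0`, handover (R)(c) 2026-08-18T09:01:19Z doc-only (`HOME/pub-hodgecm-pv06-g4/replace/HodgeCM/PerL34/CompactTorusModel.lean`, md5 9e0e28e2, 400 lines);
landed by the gen-7 packager in gate run 27 REPLACES the earlier landed copy of `HodgeCM/PerL34/CompactTorusModel.lean` (seat copy carried the packager origin header of the earlier run (stripped)).
-/
/-
Doc-only v2 (seat `planner-pub-hodgecm-pv06-g4-0`, unit pub-hodgecm-pv06-g4, 2026-08-18; answers GAPS adv1g18-X43): three comment
lines reworded — the `emb` / `emb_surj` docstrings and one overview phrase said "allowed" for MEMBERSHIP IN THE INDEX SET `X`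
(the characters of `[T]` of archimedean type `w`, tex ll. 398–400 / 405 / 409–410), while Def 3.2 allowedness is the separate predicate
`TorusCarrier.allowed : X → Prop` and the Prop 3.6 hypothesis "every such χ arises from an allowed pair" (ll. 399–400) is the open input
`ThetaModel.Inputs`/`Open_chars`, which `emb_surj` does NOT discharge.  Every declaration is byte-identical to the run-26 file.
-/
/-
Origin: HOME/pub-hodgecm-pv06-g3/lean/Pv06g3/CompactTorusModel.lean — session planner-pub-hodgecm-pv06-g3-0
(unit pub-hodgecm-pv06-g3, DAG-NODE PROVER #06 gen 3; lineage N23c, PerL v5 Prop 3.6 Step 2, tex ll. 423–432).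
Intended final place (packager's call): `HodgeCM/PerL34/CompactTorusModel.lean`.
NEW, ADDITIVE LEAF; imports my queued `Pv06g3.AnnihilationModel` (↦ `HodgeCM.PerL34.AnnihilationModel`, run 25, v5).
KIND: KERNEL — complete proofs, no new axioms, nothing cited, nothing posited.
-/
import Summits.HodgeConjecture.HodgeCM.PerL34.AnnihilationModel_2

/-!
# The compact quotient model `[T] = T(𝔸) ⧸ T(L₀)` of the torus side (PerL v5 Prop. 3.6, Step 2)

`CompactTorusDatum ν C D` (`HodgeCM/PerL34/AnnihilationModel.lean`, §4) isolates what Step 2 of the proof of PerL v5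
Prop. 3.6 (tex ll. 423–432: "…the toric periods `P_{T,ξ}(R(h)v)` vanish for every character `ξ` of `[T] = T(L₀)\T(𝔸)`
with `ξ_∞ = w` … by completeness of characters of the compact abelian group `[T]` …") needs about the compact group
`[T]`: a compact Hausdorff abelian group `K` with a finite, open-positive, right-invariant measure `μK`, a restriction
map `res : C([U(W)], ℂ) → C(K, ℂ)` along `T(𝔸) → U(W)(𝔸)` and its two defining identities `res_spec`, `res_transl`.

This file CONSTRUCTS all of that from the honest data of the adelic torus — a commutative topological group `T`
(`= T(𝔸)`), a closed countable cocompact subgroup `Λ` (`= T(L₀)`), a right-invariant open-positive measure `ν_T` with a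
`Λ`-fundamental domain `𝓕` of finite measure (pv09-g4 `CocompactFundamentalDomain`, pv11-g4 `NormOneRelTorus` supply
these for the genuine idelic torus; only the EXISTENCE of such an `𝓕` is asked, and the quotient measure is shown
independent of it, `map_restrict_eq_of_isFundamentalDomain`), and the continuous embedding `jT : T(𝔸) →* U(W)(𝔸)` with `jT(T(L₀)) ≤ U(W)(L₀)`:

* §1 quotient measures: `ν_[T] := map π (ν_T|𝓕)` on `K := T ⧸ Λ` is finite (landed
  `QuotientSmoothing.isFiniteMeasure_map_restrict`), **positive on opens** (`isOpenPosMeasure_map_restrict` — a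
  fundamental-domain argument: a `Λ`-invariant set meeting `𝓕` in a null set is null) and **left/right invariant**
  (`isMulLeftInvariant_map_restrict` for normal `Λ`, from landed `QuotientSmoothing.smulInvariantMeasure_map_restrict`;
  `isMulRightInvariant_map_restrict` for commutative `T`); `K` is a compact Hausdorff abelian group (Mathlib instances,
  `T2` from `IsClosed Λ`).
* §2 the restriction map: `resMap jT : C(T ⧸ Λ, G ⧸ Γ)`, `π t ↦ Γ·jT(t)` (realised on Mathlib's left-coset spaces as
  `↑(jT t)⁻¹`; well defined because `jT Λ ≤ Γ` and `T` is commutative), with `resMap_mk` and the equivariance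
  `resMap_mul` under the archimedean torus; hence `res := resCLM (resMap jT)` satisfies `res_spec` and `res_transl`
  BY PROOF (`resCLM_spec`, `resCLM_transl`).  `res y (π t) = y (π (jT t)⁻¹)` is literally the defining equation under
  which pv15-g2's `KernelTorusCarrier.unfold_holds_periodCLM` proves the field `unfold`.
* §3 `CompactTorusModelData ν C D`: the REMAINING genuine input of Step 2 over this model — the torus data above, the
  archimedean block (`Tc`, `ιc : T(L₀ ⊗ ℝ) →* T(𝔸)`, the weight `w`, `Ew_eq`), the type-`w` characters (`emb`,
  `emb_surj`), the finite-adelic factor (`Gf`, `ιf`, `comm`), the unfolding consequence `unfold` [AX12(ii)] (integral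
  form) and `dense` [PRINT / `AnnihilationDense`] — and the builder `CompactTorusModelData.toCompactTorusDatum`, whose
  `K, μK, TA, ιA, q, res, cl` are the model's and whose `res_spec`, `res_transl` and all ten instance slots of `K`, `μK`
  are theorems; `analytic_of_modelData` = `RepTorusCarrier.Analytic` from it.

NET EFFECT on the N23c residual (per torus side): the fields `K`+7 instances, `μK`+3 instances, `TA`, `ιA`, `q`, `res`,
`res_spec`, `cl`, `res_transl` of `CompactTorusDatum` are DISCHARGED by the quotient model; what remains is DATA
(`T, Λ, ν_T, jT`, archimedean block, `emb`, `Gf, ιf`) + `exists_fd` + the identifications `Ew_eq`, `emb_surj`, `comm` + `unfold`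
(pv15-g2: kernel for the theta-kernel model) + `dense`.
-/

set_option autoImplicit false

noncomputable section

attribute [-instance] Quotient.instMeasurableSpace

namespace HodgeCM
namespace PerL34

open MeasureTheory Filter Topology Set QuotientSmoothing
open scoped Pointwise

local notation "⟪" x ", " y "⟫" => @inner ℂ _ _ x y

/-! ## §1  Measures on a quotient group `T ⧸ Λ`: `map π (ν|𝓕)` is open-positive and invariant -/
namespace CompactTorusModel

section QuotientMeasure

variable {T : Type} [Group T] [TopologicalSpace T] [IsTopologicalGroup T] [MeasurableSpace T] [BorelSpace T]
  {Λ : Subgroup T} [Countable Λ] [MeasurableSpace (T ⧸ Λ)] [BorelSpace (T ⧸ Λ)] (ν : Measure T)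

omit [TopologicalSpace T] [IsTopologicalGroup T] [MeasurableSpace T] [BorelSpace T] [Countable Λ]
  [MeasurableSpace (T ⧸ Λ)] [BorelSpace (T ⧸ Λ)] in
/-- `π ⁻¹ U` is invariant under the right action of `Λ` (pointwise form). -/
theorem smul_preimage_mk (U : Set (T ⧸ Λ)) (γ : Λ.op) :
    γ • ((QuotientGroup.mk : T → T ⧸ Λ) ⁻¹' U) = (QuotientGroup.mk : T → T ⧸ Λ) ⁻¹' U := by
  ext x
  rw [mem_smul_set_iff_inv_smul_mem]
  simp only [mem_preimage]
  have hγ : MulOpposite.unop ((γ⁻¹ : Λ.op) : Tᵐᵒᵖ) ∈ Λ := Subgroup.mem_op.mp (γ⁻¹).2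
  change (QuotientGroup.mk (x * MulOpposite.unop ((γ⁻¹ : Λ.op) : Tᵐᵒᵖ)) : T ⧸ Λ) ∈ U ↔ _
  rw [QuotientGroup.mk_mul_of_mem x hγ]

omit [TopologicalSpace T] [IsTopologicalGroup T] [MeasurableSpace T] [BorelSpace T] [Countable Λ]
  [MeasurableSpace (T ⧸ Λ)] [BorelSpace (T ⧸ Λ)] in
/-- `π ⁻¹ U` is invariant under the right action of `Λ` (preimage form). -/
theorem preimage_smul_preimage_mk (U : Set (T ⧸ Λ)) (γ : Λ.op) :
    (fun x : T => γ • x) ⁻¹' ((QuotientGroup.mk : T → T ⧸ Λ) ⁻¹' U) = (QuotientGroup.mk : T → T ⧸ Λ) ⁻¹' U := by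
  ext x
  simp only [mem_preimage]
  have hγ : MulOpposite.unop ((γ : Λ.op) : Tᵐᵒᵖ) ∈ Λ := Subgroup.mem_op.mp γ.2
  change (QuotientGroup.mk (x * MulOpposite.unop ((γ : Λ.op) : Tᵐᵒᵖ)) : T ⧸ Λ) ∈ U ↔ _
  rw [QuotientGroup.mk_mul_of_mem x hγ]

/-- **The quotient measure `map π (ν|𝓕)` does not depend on the fundamental domain `𝓕`.** -/
theorem map_restrict_eq_of_isFundamentalDomain [ν.IsMulRightInvariant] {s t : Set T}
    (hs : IsFundamentalDomain Λ.op s ν) (ht : IsFundamentalDomain Λ.op t ν) :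
    Measure.map (QuotientGroup.mk : T → T ⧸ Λ) (ν.restrict s) =
      Measure.map (QuotientGroup.mk : T → T ⧸ Λ) (ν.restrict t) := by
  have meas_π : Measurable (QuotientGroup.mk : T → T ⧸ Λ) := continuous_quotient_mk'.measurable
  ext U hU
  rw [Measure.map_apply meas_π hU, Measure.map_apply meas_π hU, Measure.restrict_apply (meas_π hU),
    Measure.restrict_apply (meas_π hU)]
  exact hs.measure_set_eq ht (meas_π hU) (preimage_smul_preimage_mk U)

/-- **`map π (ν|𝓕)` is positive on open sets** when `ν` is and `𝓕` is a fundamental domain for the right action of the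
countable subgroup `Λ`: if an open `U ⊆ T ⧸ Λ` had measure zero, the `Λ`-invariant open set `π ⁻¹ U` would meet `𝓕` in a
null set, hence be null (`IsFundamentalDomain.measure_zero_of_invariant`), hence empty. -/
theorem isOpenPosMeasure_map_restrict [ν.IsOpenPosMeasure] [ν.IsMulRightInvariant] {𝓕 : Set T}
    (h𝓕 : IsFundamentalDomain Λ.op 𝓕 ν) :
    (Measure.map (QuotientGroup.mk : T → T ⧸ Λ) (ν.restrict 𝓕)).IsOpenPosMeasure := by
  have meas_π : Measurable (QuotientGroup.mk : T → T ⧸ Λ) := continuous_quotient_mk'.measurable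
  refine ⟨fun U hU hne => ?_⟩
  rw [Measure.map_apply meas_π hU.measurableSet, Measure.restrict_apply (meas_π hU.measurableSet)]
  intro h0
  have hE0 : ν ((QuotientGroup.mk : T → T ⧸ Λ) ⁻¹' U) = 0 :=
    h𝓕.measure_zero_of_invariant _ (fun γ => smul_preimage_mk U γ) h0
  exact (hU.preimage continuous_quotient_mk').measure_ne_zero ν (hne.preimage QuotientGroup.mk_surjective) hE0

/-- **`map π (ν|𝓕)` is left invariant** on the quotient GROUP `T ⧸ Λ` (`Λ` normal) when `ν` is left and right
invariant: left multiplication by `π g` is the action of `g`, under which the measure is invariant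
(landed `QuotientSmoothing.smulInvariantMeasure_map_restrict`). -/
theorem isMulLeftInvariant_map_restrict [Λ.Normal] [ν.IsMulLeftInvariant] [ν.IsMulRightInvariant] {𝓕 : Set T}
    (h𝓕 : IsFundamentalDomain Λ.op 𝓕 ν) :
    (Measure.map (QuotientGroup.mk : T → T ⧸ Λ) (ν.restrict 𝓕)).IsMulLeftInvariant := by
  haveI := smulInvariantMeasure_map_restrict ν h𝓕
  refine ⟨fun x => ?_⟩
  obtain ⟨g, rfl⟩ := QuotientGroup.mk_surjective x
  have hfun : (fun y : T ⧸ Λ => (QuotientGroup.mk g : T ⧸ Λ) * y) = fun y : T ⧸ Λ => g • y := by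
    funext y
    obtain ⟨h, rfl⟩ := QuotientGroup.mk_surjective y
    rw [← QuotientGroup.mk_mul, MulAction.Quotient.smul_mk, smul_eq_mul]
  rw [hfun]
  exact MeasureTheory.map_smul g _

end QuotientMeasure

section CommQuotientMeasure

variable {T : Type} [CommGroup T] [TopologicalSpace T] [IsTopologicalGroup T] [MeasurableSpace T] [BorelSpace T]
  {Λ : Subgroup T} [Countable Λ] [MeasurableSpace (T ⧸ Λ)] [BorelSpace (T ⧸ Λ)] (ν : Measure T)

omit [TopologicalSpace T] [IsTopologicalGroup T] [BorelSpace T] in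
/-- On a commutative group a right-invariant measure is left invariant. -/
theorem isMulLeftInvariant_of_isMulRightInvariant [ν.IsMulRightInvariant] : ν.IsMulLeftInvariant :=
  ⟨fun g => by simp_rw [mul_comm g]; exact map_mul_right_eq_self ν g⟩

/-- **`map π (ν|𝓕)` is right invariant** on the compact abelian group `T ⧸ Λ` (the instance slot `instμK₃` of
`CompactTorusDatum`). -/
theorem isMulRightInvariant_map_restrict [ν.IsMulRightInvariant] {𝓕 : Set T} (h𝓕 : IsFundamentalDomain Λ.op 𝓕 ν) :
    (Measure.map (QuotientGroup.mk : T → T ⧸ Λ) (ν.restrict 𝓕)).IsMulRightInvariant := by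
  haveI := isMulLeftInvariant_of_isMulRightInvariant ν
  haveI := isMulLeftInvariant_map_restrict ν h𝓕
  infer_instance

end CommQuotientMeasure

/-! ## §2  The restriction map `[T] → [U(W)]` -/
section ResMap

variable {G : Type} [Group G] [TopologicalSpace G] [IsTopologicalGroup G] {Γ : Subgroup G}
variable {T : Type} [CommGroup T] [TopologicalSpace T] {Λ : Subgroup T}

/-- **The map `[T] → [U(W)]`, `T(L₀)·t ↦ U(W)(L₀)·jT(t)`**, realised on Mathlib's left-coset spaces as
`π t ↦ ↑(jT t)⁻¹`; well defined since `jT Λ ≤ Γ` (and `T` is commutative), continuous since `jT` is. -/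
def resMap (jT : T →* G) (hc : Continuous jT) (hΛ : Λ ≤ Γ.comap jT) : C(T ⧸ Λ, G ⧸ Γ) where
  toFun k := Quotient.liftOn' k (fun t : T => (((jT t)⁻¹ : G) : G ⧸ Γ)) (fun a b hab => by
    rw [QuotientGroup.leftRel_apply] at hab
    show (((jT a)⁻¹ : G) : G ⧸ Γ) = (((jT b)⁻¹ : G) : G ⧸ Γ)
    rw [QuotientGroup.eq, inv_inv, ← map_inv, ← map_mul]
    have hab' : a * b⁻¹ ∈ Λ := by
      rw [show a * b⁻¹ = (a⁻¹ * b)⁻¹ by rw [mul_inv_rev, inv_inv, mul_comm]]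
      exact Λ.inv_mem hab
    exact Subgroup.mem_comap.mp (hΛ hab'))
  continuous_toFun := (continuous_quotient_mk'.comp hc.inv).quotient_liftOn' _

variable (jT : T →* G) (hc : Continuous jT) (hΛ : Λ ≤ Γ.comap jT)

/-- (Ported verbatim from the HodgeCMPerL package; no docstring in the source.) -/
@[simp] theorem resMap_mk (t : T) : resMap jT hc hΛ (QuotientGroup.mk t) = (((jT t)⁻¹ : G) : G ⧸ Γ) := rfl

/-- Equivariance under the archimedean torus `ιc : T(L₀ ⊗ ℝ) →* T(𝔸)`:
`resMap (k · π(ιc t)) = (jT (ιc t))⁻¹ • resMap k` — the hypothesis of `resCLM_transl`. -/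
theorem resMap_mul {Tc : Type} [Group Tc] (ιc : Tc →* T) (k : T ⧸ Λ) (t : Tc) :
    resMap jT hc hΛ (k * ((QuotientGroup.mk' Λ).comp ιc) t) = ((jT.comp ιc) t)⁻¹ • resMap jT hc hΛ k := by
  obtain ⟨s, rfl⟩ := QuotientGroup.mk_surjective k
  rw [MonoidHom.comp_apply, QuotientGroup.mk'_apply, ← QuotientGroup.mk_mul, resMap_mk, resMap_mk, map_mul,
    mul_inv_rev, MonoidHom.comp_apply, MulAction.Quotient.smul_mk, smul_eq_mul]

end ResMap

end CompactTorusModel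

/-! ## §3  The remaining input over the quotient model and the builder -/
namespace Annihilation

open CompactTorusModel

section ModelData

variable {G : Type} [Group G] [TopologicalSpace G] [IsTopologicalGroup G] {Γ : Subgroup G}
  [MeasurableSpace (G ⧸ Γ)] [BorelSpace (G ⧸ Γ)] [CompactSpace (G ⧸ Γ)]
  (ν : Measure (G ⧸ Γ)) [IsFiniteMeasure ν]
variable {HG CG SK SigIdxG : Type}
variable [NormedAddCommGroup HG] [InnerProductSpace ℂ HG] [CompleteSpace HG]
variable [NormedAddCommGroup CG] [NormedSpace ℂ CG] [TopologicalSpace SK]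

/-- **The genuine input of PerL v5 Prop. 3.6 Step 2 over the compact quotient model of `[T]`.**  Compared with
`CompactTorusDatum`, the compact group `K`, its measure `μK`, all their instances, `TA`, `ιA`, `q`, the restriction `res`,
the class map `cl` and the identities `res_spec`, `res_transl` are no longer fields: they are built / proved by
`toCompactTorusDatum` from the torus DATA below. -/
structure CompactTorusModelData (C : RepCoreCarrier (Lp ℂ 2 ν) HG CG G SK SigIdxG) (D : RepTorusCarrier C) where
  /-- the adelic torus `T(𝔸)`: a commutative topological group with its Borel σ-algebra -/
  T : Type
  [instT₁ : CommGroup T]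
  [instT₂ : TopologicalSpace T]
  [instT₃ : IsTopologicalGroup T]
  [instT₄ : MeasurableSpace T]
  [instT₅ : BorelSpace T]
  /-- the rational points `T(L₀)`: a closed countable subgroup with compact quotient (Borel σ-algebra on the quotient) -/
  Λ : Subgroup T
  [instΛ₁ : Countable Λ]
  [instΛ₂ : IsClosed (Λ : Set T)]
  [instQ₁ : MeasurableSpace (T ⧸ Λ)]
  [instQ₂ : BorelSpace (T ⧸ Λ)]
  [instQ₃ : CompactSpace (T ⧸ Λ)]
  /-- a right-invariant measure on `T(𝔸)` positive on open sets (a Haar measure) … -/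
  νT : Measure T
  [instν₁ : νT.IsMulRightInvariant]
  [instν₂ : νT.IsOpenPosMeasure]
  /-- … admitting a fundamental domain of finite measure for the right action of `T(L₀)` (for a discrete cocompact
  `T(L₀)` in a locally compact `T(𝔸)` and `νT` finite on compacts: pv09-g4
  `DiscreteFD.exists_isFundamentalDomain_op_finite'`) -/
  exists_fd : ∃ 𝓕 : Set T, IsFundamentalDomain Λ.op 𝓕 νT ∧ νT 𝓕 < ⊤
  /-- the embedding `T(𝔸) →* U(W)(𝔸)`: continuous, mapping `T(L₀)` into `U(W)(L₀)` -/
  jT : T →* G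
  jT_cont : Continuous jT
  jT_Λ : Λ ≤ Γ.comap jT
  /-- the compact group `T(L₀ ⊗ ℝ)` with its normalised Haar measure and its inclusion `ιc` into `T(𝔸)` -/
  Tc : Type
  [instTc₁ : Group Tc]
  [instTc₂ : TopologicalSpace Tc]
  [instTc₃ : IsTopologicalGroup Tc]
  [instTc₄ : CompactSpace Tc]
  [instTc₅ : MeasurableSpace Tc]
  [instTc₆ : BorelSpace Tc]
  μ : Measure Tc
  [instμ₁ : IsProbabilityMeasure μ]
  [instμ₂ : μ.IsMulLeftInvariant]
  ιc : Tc →* T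
  ιc_cont : Continuous ιc
  /-- the weight character `w = χ_∞|_{T(L₀⊗ℝ)}` of the isolated type, continuous and unitary -/
  w : Tc →* ℂ
  w_cont : Continuous w
  w_norm : ∀ t, ‖w t‖ = 1
  /-- [DEFINITIONAL] the torus side's weight space IS the joint eigenspace of `(jT ∘ ιc, w)` -/
  Ew_eq : D.Ew = RepDecomp.Ew C.R (jT.comp ιc) w
  /-- the characters of `[T] = T ⧸ Λ` of archimedean type `w` — the index set `X` (tex ll. 398–400); membership in `X` is
  NOT Def 3.2 allowedness, which is the separate predicate `TorusCarrier.allowed : X → Prop` -/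
  emb : D.X → PontryaginDual (T ⧸ Λ)
  /-- [DEFINITIONAL] every character of `[T]` with `ξ_∞ = w` lies in the index set `X` (Step 2 indexes `E^χ_f` by ALL such
  `χ`: l. 405, ll. 409–410, used at ll. 425–427); NOT the Prop 3.6 hypothesis "arises from an allowed pair" (ll. 399–400 = the open
  input `Open_chars`), which Step 2 does not use -/
  emb_surj : ∀ ξ : PontryaginDual (T ⧸ Λ), (dualChar ξ).comp ((QuotientGroup.mk' Λ).comp ιc) = w → ∃ χ : D.X, emb χ = ξ
  /-- the finite-adelic factor `U(W)(𝔸_f)`, commuting with the archimedean torus -/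
  Gf : Type
  [instGf : Group Gf]
  ιf : Gf →* G
  comm : ∀ (hf : Gf) (t : Tc), ιf hf * jT (ιc t) = jT (ιc t) * ιf hf
  /-- [AX12(ii)] the unfolding identity, consequence form, over the quotient model, for every fundamental domain `𝓕`
  of finite measure (integral form of `periodCLM (map π (νT|𝓕)) (emb χ) (resCLM (resMap jT) (translC h x)) = 0`;
  the quotient measure does not depend on `𝓕`, `map_restrict_eq_of_isFundamentalDomain`; pv15-g2
  `KernelTorusCarrier.unfold_holds_periodCLM` proves exactly this, for every `𝓕`, in the theta-kernel model) -/
  unfold : ∀ (𝓕 : Set T), IsFundamentalDomain Λ.op 𝓕 νT → νT 𝓕 < ⊤ →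
    ∀ (x : C(G ⧸ Γ, ℂ)) (χ : D.X), (∀ f, ⟪D.E χ f, ContinuousMap.toLp (E := ℂ) 2 ν ℂ x⟫ = 0) → ∀ h : G,
    ∫ k, resCLM (resMap jT jT_cont jT_Λ) (translC h x) k * starRingEnd ℂ (dualChar (emb χ) k)
      ∂(Measure.map (QuotientGroup.mk : T → T ⧸ Λ) (νT.restrict 𝓕)) = 0
  /-- [PRINT] `U(W)(L₀) · T(𝔸) · U(W)(𝔸_f)` is dense in `U(W)(𝔸)` (kernel supplement `AnnihilationDense`) -/
  dense : Dense {g : G | ∃ γ ∈ Γ, ∃ (t : T) (hf : Gf), g = γ * jT t * ιf hf}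

attribute [instance] CompactTorusModelData.instT₁ CompactTorusModelData.instT₂ CompactTorusModelData.instT₃
  CompactTorusModelData.instT₄ CompactTorusModelData.instT₅ CompactTorusModelData.instΛ₁ CompactTorusModelData.instΛ₂
  CompactTorusModelData.instQ₁ CompactTorusModelData.instQ₂ CompactTorusModelData.instQ₃
  CompactTorusModelData.instν₁ CompactTorusModelData.instν₂
  CompactTorusModelData.instTc₁ CompactTorusModelData.instTc₂ CompactTorusModelData.instTc₃
  CompactTorusModelData.instTc₄ CompactTorusModelData.instTc₅ CompactTorusModelData.instTc₆
  CompactTorusModelData.instμ₁ CompactTorusModelData.instμ₂ CompactTorusModelData.instGf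

namespace CompactTorusModelData

variable {ν}
variable {C : RepCoreCarrier (Lp ℂ 2 ν) HG CG G SK SigIdxG} {D : RepTorusCarrier C}

/-- A fundamental domain of finite measure for `T(L₀)` acting on `T(𝔸)` on the right (chosen). -/
def 𝓕 (M : CompactTorusModelData ν C D) : Set M.T := M.exists_fd.choose

/-- (Ported verbatim from the HodgeCMPerL package; no docstring in the source.) -/
theorem isFundamentalDomain_𝓕 (M : CompactTorusModelData ν C D) : IsFundamentalDomain M.Λ.op M.𝓕 M.νT :=
  M.exists_fd.choose_spec.1

/-- (Ported verbatim from the HodgeCMPerL package; no docstring in the source.) -/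
theorem measure_𝓕_lt_top (M : CompactTorusModelData ν C D) : M.νT M.𝓕 < ⊤ :=
  M.exists_fd.choose_spec.2

/-- The quotient model's measure `ν_[T] := map π (ν_T|𝓕)` on `[T] = T ⧸ Λ` … -/
def μK (M : CompactTorusModelData ν C D) : Measure (M.T ⧸ M.Λ) :=
  Measure.map (QuotientGroup.mk : M.T → M.T ⧸ M.Λ) (M.νT.restrict M.𝓕)

/-- … which is the same for every fundamental domain. -/
theorem μK_eq (M : CompactTorusModelData ν C D) {𝓕' : Set M.T} (h : IsFundamentalDomain M.Λ.op 𝓕' M.νT) :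
    M.μK = Measure.map (QuotientGroup.mk : M.T → M.T ⧸ M.Λ) (M.νT.restrict 𝓕') :=
  map_restrict_eq_of_isFundamentalDomain M.νT M.isFundamentalDomain_𝓕 h

/-- (Ported verbatim from the HodgeCMPerL package; no docstring in the source.) -/
instance isFiniteMeasure_μK (M : CompactTorusModelData ν C D) : IsFiniteMeasure M.μK :=
  isFiniteMeasure_map_restrict (Γ := M.Λ) M.νT M.measure_𝓕_lt_top.ne

/-- (Ported verbatim from the HodgeCMPerL package; no docstring in the source.) -/
instance isOpenPosMeasure_μK (M : CompactTorusModelData ν C D) : M.μK.IsOpenPosMeasure :=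
  isOpenPosMeasure_map_restrict M.νT M.isFundamentalDomain_𝓕

/-- (Ported verbatim from the HodgeCMPerL package; no docstring in the source.) -/
instance isMulRightInvariant_μK (M : CompactTorusModelData ν C D) : M.μK.IsMulRightInvariant :=
  isMulRightInvariant_map_restrict M.νT M.isFundamentalDomain_𝓕

/-- The restriction `res : C([U(W)], ℂ) →L[ℂ] C([T], ℂ)` of the quotient model. -/
def res (M : CompactTorusModelData ν C D) : C(G ⧸ Γ, ℂ) →L[ℂ] C(M.T ⧸ M.Λ, ℂ) :=
  resCLM (resMap M.jT M.jT_cont M.jT_Λ)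

/-- `res_spec` PROVED: `res x (π t) = x(Γ·jT t)`. -/
theorem res_spec (M : CompactTorusModelData ν C D) (x : C(G ⧸ Γ, ℂ)) (t : M.T) :
    M.res x (QuotientGroup.mk t) = evC (M.jT t) x :=
  resCLM_spec _ M.jT QuotientGroup.mk (resMap_mk M.jT M.jT_cont M.jT_Λ) x t

/-- `res_transl` PROVED: `res (R(ιT t) x) k = res x (k · cl t)` with `ιT = jT ∘ ιc`, `cl = π ∘ ιc`. -/
theorem res_transl (M : CompactTorusModelData ν C D) (t : M.Tc) (x : C(G ⧸ Γ, ℂ)) (k : M.T ⧸ M.Λ) :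
    M.res (translC ((M.jT.comp M.ιc) t) x) k = M.res x (k * ((QuotientGroup.mk' M.Λ).comp M.ιc) t) :=
  resCLM_transl _ (M.jT.comp M.ιc) ((QuotientGroup.mk' M.Λ).comp M.ιc) (resMap_mul M.jT M.jT_cont M.jT_Λ M.ιc) t x k

/-- **The builder**: a `CompactTorusDatum` whose compact group is `[T] = T ⧸ Λ` with `μK = map π (ν_T|𝓕)`, whose
restriction is `resCLM (resMap jT)` and whose `res_spec`, `res_transl` and instance slots are THEOREMS. -/
def toCompactTorusDatum (M : CompactTorusModelData ν C D) : CompactTorusDatum ν C D where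
  Tc := M.Tc
  μ := M.μ
  ιT := M.jT.comp M.ιc
  ιT_cont := M.jT_cont.comp M.ιc_cont
  w := M.w
  w_cont := M.w_cont
  w_norm := M.w_norm
  Ew_eq := M.Ew_eq
  K := M.T ⧸ M.Λ
  μK := M.μK
  TA := M.T
  ιA := M.jT
  q := QuotientGroup.mk
  res := M.res
  res_spec := M.res_spec
  cl := (QuotientGroup.mk' M.Λ).comp M.ιc
  res_transl := M.res_transl
  emb := M.emb
  emb_surj := M.emb_surj
  Gf := M.Gf
  ιf := M.ιf
  comm := M.comm
  unfold := fun x χ hx h => by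
    rw [periodCLM_apply]
    exact M.unfold M.𝓕 M.isFundamentalDomain_𝓕 M.measure_𝓕_lt_top x χ hx h
  dense := M.dense

/-- (Ported verbatim from the HodgeCMPerL package; no docstring in the source.) -/
@[simp] theorem toCompactTorusDatum_K (M : CompactTorusModelData ν C D) : M.toCompactTorusDatum.K = (M.T ⧸ M.Λ) := rfl

/-- (Ported verbatim from the HodgeCMPerL package; no docstring in the source.) -/
@[simp] theorem toCompactTorusDatum_μK (M : CompactTorusModelData ν C D) : M.toCompactTorusDatum.μK = M.μK := rfl

/-- (Ported verbatim from the HodgeCMPerL package; no docstring in the source.) -/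
@[simp] theorem toCompactTorusDatum_res (M : CompactTorusModelData ν C D) : M.toCompactTorusDatum.res = M.res := rfl

variable [SMulInvariantMeasure G (G ⧸ Γ) ν] [T2Space (G ⧸ Γ)] [ν.InnerRegularCompactLTTop]

/-- **[AX8] over the compact quotient model of the torus.** -/
theorem AX8_annihilation (M : CompactTorusModelData ν C D) (S : SmoothingData ν C.R) (hR : C.R = ρHom ν)
    (hC : C.Analytic) (h12a : ∀ (h : G) χ f, C.R h (D.E χ f) = D.E χ (D.ETransl h χ f)) (v : Lp ℂ 2 ν)
    (hv : ∀ χ f, ⟪D.E χ f, v⟫ = 0) : D.toTorusCarrier.Pw v = 0 :=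
  M.toCompactTorusDatum.AX8_annihilation S hR hC h12a v hv

/-- **`RepTorusCarrier.Analytic` over the compact quotient model** = `Analytic5` + `CompactTorusModelData` + `SmoothingData`. -/
theorem analytic_of_modelData (h5 : D.Analytic5) (M : CompactTorusModelData ν C D) (S : SmoothingData ν C.R)
    (hR : C.R = ρHom ν) (hC : C.Analytic) : D.Analytic :=
  CompactTorusDatum.analytic h5 M.toCompactTorusDatum S hR hC

end CompactTorusModelData

end ModelData

end Annihilation

end PerL34
end HodgeCM
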